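import Summits.QuantumFields.YangMills.Theorems.BalabanLadderUVSeamRecCeilingsTorusDLRMeasurable
import Summits.QuantumFields.YangMills.Theorems.BalabanLadderUVSeamRecPolymerData
import HarnessLib

/-!
# Crux `UVSeamRec` (stmt-QuantumFields-20043), lane B: DLR-PEELING — a cube-kernel bound UNIFORM IN THE EXTERIOR gives the Peierls
# product law on EVERY torus (no reflection positivity, no divisibility); the link supports of Bałaban's block-field events

Helper file (`--supports stmt-QuantumFields-20043`) of the width-lever seat `ym-20043-ceilings-p2` (lane B, gen 6); sequel of
`…CeilingsTorusDLRMeasurable` (the torus DLR step for bounded MEASURABLE cylinder observables with a measurable spectator); consumed by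
`…CeilingsDLRPeelingWindowCellLaw` (thinning of window families + assembly in the letters of the window cell laws hWCL of p554392).

THE POINT (lane B's strategy sentence made honest: «large-field rarity on ALL odd tori WITHOUT reflection positivity … evading the
collar-scale divisibility obstruction at prime sides»).  Lane B's supplier target for the large-field half of (RM) is a PRODUCT LAW
`⟨∏_{γ∈A} 1_{E_γ}∘lift⟩_{2L+1,β} ≤ ∏ δ_k` for Bałaban's level-`k` block-field events `E_γ = largeFieldEvent 𝔟 ε γ` on every odd torus.
§1 proves the RP-free, divisibility-free ENGINE (`torusE_prod_le_prod_of_kerE_le`): if finitely many cubes `Q_i = (c_i, b_i)` have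
pairwise disjoint closed site windows inside one torus window and `F_i ∈ [0,1]` are measurable cylinder observables read inside the
windows, then a bound of each cube-kernel mean UNIFORM IN THE EXTERIOR, `kerE^η_{Q_i}(F_i) ≤ w_i ∀η`, gives `E_T[∏ F_i] ≤ ∏ w_i` (any
compact `G`, any lattice representation, any `β`, any torus side): peel one cube at a time through the torus DLR step with the other factors
as exterior spectator (they read no interior link of the cube), bound the kernel, recurse.  §2 records the formal link support of the chart,
of `blockField` and of the indicator of `largeFieldEvent` (the chart box `b^k(y − (b−1)) + [0, 2b^{k+1})⁴`) and that this box sits in the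
closed window of the COLLAR CUBE of corner `b^k(y − m)` and side `(2m+1)b^k` once `m ≥ b` (`chartBox_window`).

HONEST FRAMING.  The engine turns lane B's torus-side product laws into ONE-BOX statements with Dirichlet (exterior) data — no torus, hence
no seam and no divisibility; the one-box large-field estimate itself (uniform conditional rarity of N20's block-field event in a collar
cube, the R-operation currency of [Balaban1989LargeFieldII] with boundary conditions) is OPEN and is classically inconsistent for
thresholds below the flat-penetration value `1 − cos(π²/(2m+1)²) ≈ π⁴/(2(2m+1)⁴)` of the central block field (coarse plaquette angle
`π²/(2m+1)²`; LEAD 20043 FINDING #50); see the sequel's docstrings.  Folklore probability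
(Georgii 2011 (4.18), Rem. 1.24; Friedli–Velenik 2017 (6.34); Peierls peeling); nothing of E0′; not a gap, not Clay.
-/

set_option autoImplicit false

noncomputable section

open MeasureTheory Filter Topology Finset
open Literature.Probability.LatticeModels
open Literature.MathematicalPhysics.QuantumFieldTheory (GaugeConfig wilsonMeasure LatticeRep isProbabilityMeasure_wilsonMeasure
  measurable_torusLift)
open Literature.MathematicalPhysics.QuantumLattice (LGConfig torusLift IsCylinder ymSpecification isProbabilityMeasure_ymSpecification
  integrable_of_abs_le)

namespace Summit.QuantumFields.YangMills.Cruxes.UVSeamRec.DLRPeeling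

open Summit.QuantumFields.YangMills.Cruxes.OSLegsFromFemtoAndGap.DlrCollarTransfer
open Summit.QuantumFields.YangMills.Cruxes.NT.MarkovMirror (cubeEdges_fst_window)
open Summit.QuantumFields.YangMills.Cruxes.UVSeamRec.PolymerData

/-! ## §1 The peeling engine: uniform cube-kernel bounds ⇒ product law on every torus -/

section Peeling

variable (G : Type) [Group G] [TopologicalSpace G] [IsTopologicalGroup G] [CompactSpace G]
  [MeasurableSpace G] [BorelSpace G] (r : LatticeRep G)

omit [Group G] [TopologicalSpace G] [IsTopologicalGroup G] [CompactSpace G] [MeasurableSpace G] [BorelSpace G] in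
/-- A finite product of cylinder observables is a cylinder observable on the union of the supports. [folklore] -/
theorem isCylinder_prod {ι : Type*} (s : Finset ι) {F : ι → LGConfig 4 G → ℝ}
    {S : ι → Finset (Literature.MathematicalPhysics.QuantumLattice.ZdEdge 4)} (h : ∀ i ∈ s, IsCylinder (F i) (S i)) :
    IsCylinder (fun U => ∏ i ∈ s, F i U) (s.biUnion S) := by
  classical
  intro U V hUV
  refine Finset.prod_congr rfl fun i hi => h i hi fun e he => hUV e ?_
  exact Finset.mem_coe.2 (Finset.mem_biUnion.2 ⟨i, hi, Finset.mem_coe.1 he⟩)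

/-- A cube-kernel mean of an observable with values in `[0, 1]` lies in `[0, 1]`. [folklore] -/
theorem kerE_mem_Icc_of_mem_Icc (β : ℝ) (c : Fin 4 → ℤ) (b : ℕ) (η : LGConfig 4 G) {F : LGConfig 4 G → ℝ}
    (hF : ∀ U, 0 ≤ F U ∧ F U ≤ 1) : 0 ≤ kerE G r β c b η F ∧ kerE G r β c b η F ≤ 1 := by
  haveI := r.secondCountableTopology
  haveI := isProbabilityMeasure_ymSpecification r.ρ r.continuous β (cubeEdges c b) η
  unfold kerE
  refine ⟨integral_nonneg fun U => (hF U).1, ?_⟩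
  calc ∫ U, F U ∂(ymSpecification (d := 4) r.ρ β (cubeEdges c b) η) ≤ ∫ _U, (1 : ℝ) ∂(ymSpecification (d := 4) r.ρ β (cubeEdges c b) η) :=
        integral_mono_of_nonneg (ae_of_all _ fun U => (hF U).1) (integrable_const _) (ae_of_all _ fun U => (hF U).2)
    _ = 1 := by rw [integral_const, smul_eq_mul, mul_one, probReal_univ]

/-- **DLR PEELING: uniform cube-kernel bounds give the Peierls product law on EVERY torus — no reflection positivity, no
divisibility.**  Torus of side `2L+1` (any `L`), any compact `G`, any lattice representation, any `β`.  Cubes `Q_i = (c_i, b_i)`,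
`i ∈ s`, inside the torus window `lo + [1, 2L − 1 − b_i]` coordinatewise, with pairwise DISJOINT closed site windows `[c_i, c_i + b_i]`
(separated in some coordinate); measurable cylinder observables `F_i ∈ [0, 1]` whose links are based in `[c_i, c_i + b_i]`; weights
`w_i ≥ 0` bounding the cube-kernel means UNIFORMLY IN THE EXTERIOR: `kerE^η_{Q_i}(F_i) ≤ w_i` for every `η`.  Then
`E_T[∏_{i∈s} F_i] ≤ ∏_{i∈s} w_i`.  Proof: induction on `s`; pull `F_a` through `Q_a` with the spectator `∏_{i≠a} F_i` (it reads no
interior link of `Q_a` by the window disjointness) using the MEASURABLE spectator DLR step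
(`integral_mul_lift_eq_integral_mul_kerE_of_measurable`), bound the kernel mean by `w_a`, recurse. [folklore] -/
theorem torusE_prod_le_prod_of_kerE_le (β : ℝ) (L : ℕ) (lo : Fin 4 → ℤ) {ι : Type*} (s : Finset ι)
    (c : ι → Fin 4 → ℤ) (b : ι → ℕ)
    (hc : ∀ i ∈ s, ∀ j, lo j + 1 ≤ c i j ∧ c i j + (b i : ℤ) + 2 ≤ lo j + (2 * L + 1 : ℕ))
    (hdisj : ∀ i ∈ s, ∀ i' ∈ s, i ≠ i' → ∃ j, c i j + (b i : ℤ) + 1 ≤ c i' j ∨ c i' j + (b i' : ℤ) + 1 ≤ c i j)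
    (F : ι → LGConfig 4 G → ℝ) (hFm : ∀ i ∈ s, Measurable (F i)) (hF01 : ∀ i ∈ s, ∀ U, 0 ≤ F i U ∧ F i U ≤ 1)
    (S : ι → Finset (Literature.MathematicalPhysics.QuantumLattice.ZdEdge 4)) (hFS : ∀ i ∈ s, IsCylinder (F i) (S i))
    (hS : ∀ i ∈ s, ∀ e ∈ S i, ∀ j, c i j ≤ e.1 j ∧ e.1 j ≤ c i j + b i)
    (w : ι → ℝ) (hw0 : ∀ i ∈ s, 0 ≤ w i) (hw : ∀ i ∈ s, ∀ η, kerE G r β (c i) (b i) η (F i) ≤ w i) :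
    torusE G r β L (fun U => ∏ i ∈ s, F i U) ≤ ∏ i ∈ s, w i := by
  classical
  haveI := isProbabilityMeasure_wilsonMeasure (d := 4) (L := 2 * L + 1) r.ρ r.continuous β
  induction s using Finset.induction_on with
  | empty =>
    simp only [Finset.prod_empty]
    unfold torusE
    rw [integral_const, smul_eq_mul, mul_one, probReal_univ]
  | insert a s ha ih =>
    have ih' := ih (fun i hi => hc i (Finset.mem_insert_of_mem hi))
      (fun i hi i' hi' hne => hdisj i (Finset.mem_insert_of_mem hi) i' (Finset.mem_insert_of_mem hi') hne)
      (fun i hi => hFm i (Finset.mem_insert_of_mem hi)) (fun i hi => hF01 i (Finset.mem_insert_of_mem hi))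
      (fun i hi => hFS i (Finset.mem_insert_of_mem hi)) (fun i hi => hS i (Finset.mem_insert_of_mem hi))
      (fun i hi => hw0 i (Finset.mem_insert_of_mem hi)) (fun i hi => hw i (Finset.mem_insert_of_mem hi))
    have ha' : a ∈ insert a s := Finset.mem_insert_self a s
    -- the spectator `H = ∏_{i ∈ s} F_i`
    set H : LGConfig 4 G → ℝ := fun U => ∏ i ∈ s, F i U with hHdef
    have hH01 : ∀ U, 0 ≤ H U ∧ H U ≤ 1 := fun U =>
      ⟨Finset.prod_nonneg fun i hi => (hF01 i (Finset.mem_insert_of_mem hi) U).1,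
        Finset.prod_le_one (fun i hi => (hF01 i (Finset.mem_insert_of_mem hi) U).1)
          fun i hi => (hF01 i (Finset.mem_insert_of_mem hi) U).2⟩
    have hHm : Measurable H := Finset.measurable_prod s fun i hi => hFm i (Finset.mem_insert_of_mem hi)
    have hHabs : ∀ U, |H U| ≤ 1 := fun U => by rw [abs_of_nonneg (hH01 U).1]; exact (hH01 U).2
    have hFabs : ∀ U, |F a U| ≤ 1 := fun U => by rw [abs_of_nonneg (hF01 a ha' U).1]; exact (hF01 a ha' U).2
    have hHS : IsCylinder H (s.biUnion S) := isCylinder_prod G s fun i hi => hFS i (Finset.mem_insert_of_mem hi)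
    -- the spectator reads no interior link of `Q_a` and sits in the torus window
    have hSHoff : ∀ e ∈ s.biUnion S, e ∉ cubeEdges (c a) (b a) := by
      intro e he hmem
      obtain ⟨i, hi, hei⟩ := Finset.mem_biUnion.1 he
      have hne : a ≠ i := fun h => ha (h ▸ hi)
      obtain ⟨j, hj⟩ := hdisj a ha' i (Finset.mem_insert_of_mem hi) hne
      have h1 := cubeEdges_fst_window hmem j
      have h2 := hS i (Finset.mem_insert_of_mem hi) e hei j
      rcases hj with hj | hj <;> linarith [h1.1, h1.2, h2.1, h2.2]
    have hSHwin : ∀ e ∈ s.biUnion S, ∀ j, lo j + 1 ≤ e.1 j ∧ e.1 j + 2 ≤ lo j + (2 * L + 1 : ℕ) := by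
      intro e he j
      obtain ⟨i, hi, hei⟩ := Finset.mem_biUnion.1 he
      have h1 := hc i (Finset.mem_insert_of_mem hi) j
      have h2 := hS i (Finset.mem_insert_of_mem hi) e hei j
      constructor <;> linarith [h1.1, h1.2, h2.1, h2.2]
    -- peel `Q_a`
    have hstep : torusE G r β L (fun U => ∏ i ∈ insert a s, F i U) =
        torusE G r β L (fun η => H η * kerE G r β (c a) (b a) η (F a)) := by
      have hprod : (fun U : LGConfig 4 G => ∏ i ∈ insert a s, F i U) = fun U => H U * F a U := by
        funext U; rw [Finset.prod_insert ha, mul_comm]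
      rw [hprod]
      unfold torusE
      exact integral_mul_lift_eq_integral_mul_kerE_of_measurable G r β (c a) (b a) (2 * L + 1) lo (hc a ha')
        (hFm a ha') hHm hFabs hHabs (hFS a ha') hHS (hS a ha') hSHoff hSHwin
    rw [hstep, Finset.prod_insert ha]
    -- bound the kernel mean by `w_a`
    have hle : torusE G r β L (fun η => H η * kerE G r β (c a) (b a) η (F a)) ≤ torusE G r β L (fun η => H η * w a) := by
      unfold torusE
      refine integral_mono_of_nonneg (ae_of_all _ fun U => mul_nonneg (hH01 _).1
        (kerE_mem_Icc_of_mem_Icc G r β (c a) (b a) _ (hF01 a ha')).1) ?_ (ae_of_all _ fun U =>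
        mul_le_mul_of_nonneg_left (hw a ha' _) (hH01 _).1)
      exact integrable_of_abs_le ((hHm.mul measurable_const).comp (measurable_torusLift _)) (C := 1 * w a)
        fun U => by rw [abs_mul, abs_of_nonneg (hw0 a ha')]; exact mul_le_mul_of_nonneg_right (hHabs _) (hw0 a ha')
    refine hle.trans ?_
    have hconst : torusE G r β L (fun η => H η * w a) = w a * torusE G r β L H := by
      unfold torusE; rw [integral_mul_const, mul_comm]
    rw [hconst]
    exact mul_le_mul_of_nonneg_left ih' (hw0 a ha')

end Peeling

/-! ## §2 The link support of the chart, of `blockField` and of the large-field events -/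

section Support

/-- The chart of origin `o` on the wave-0 torus with `M` sites per direction reads only the links based in the box
`o + [0, M)⁴`. [folklore] -/
theorem isCylinder_chart {G : Type*} {M : ℕ} [NeZero M] (o : Fin 4 → ℤ) :
    IsCylinder (fun η : LGConfig 4 G => chart (M := M) o η)
      ((Fintype.piFinset fun i => Finset.Ico (o i) (o i + M)) ×ˢ (Finset.univ : Finset (Fin 4))) := by
  intro η η' h
  funext e
  simp only [chart_apply]
  refine h _ (Finset.mem_coe.2 (Finset.mem_product.2 ⟨Fintype.mem_piFinset.2 fun i => Finset.mem_Ico.2 ⟨?_, ?_⟩,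
    Finset.mem_univ _⟩))
  · have := (e.1 i).val.zero_le
    simp only [le_add_iff_nonneg_right, Int.natCast_nonneg]
  · have := ZMod.val_lt (e.1 i)
    simp only [add_lt_add_iff_left, Int.ofNat_lt, this]

variable {N : ℕ} [NeZero N]

/-- **Formal link support of the block-averaged field.**  `blockField 𝔟 k y μ ν` reads only the links of the chart box
`b^k(y − (b−1)) + [0, 2b^{k+1})⁴` (base points), i.e. it is a cylinder observable on that box. [folklore] -/
theorem isCylinder_blockField (𝔟 : BlockSize) (k : ℕ) (y : Fin 4 → ℤ) (μ ν : Fin 4) (h : μ < ν) :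
    IsCylinder (blockField (N := N) 𝔟 k y μ ν h)
      ((Fintype.piFinset fun i => Finset.Ico (chartOrigin 𝔟 k y i)
        (chartOrigin 𝔟 k y i + (chartParams 𝔟 k).sitesPerDir 0)) ×ˢ (Finset.univ : Finset (Fin 4))) := by
  intro η η' hηη'
  have hc : chart (M := (chartParams 𝔟 k).sitesPerDir 0) (chartOrigin 𝔟 k y) η =
      chart (M := (chartParams 𝔟 k).sitesPerDir 0) (chartOrigin 𝔟 k y) η' := isCylinder_chart _ hηη'
  unfold blockField
  rw [hc]

/-- **Formal link support of N20's large-field event**: the indicator of `largeFieldEvent 𝔟 ε γ` is a cylinder observable on the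
chart box of `γ`. [folklore] -/
theorem isCylinder_indicator_largeFieldEvent (𝔟 : BlockSize) (ε : ℝ) (γ : Polymer) :
    IsCylinder ((largeFieldEvent (N := N) 𝔟 ε γ).indicator fun _ => (1 : ℝ))
      ((Fintype.piFinset fun i => Finset.Ico (chartOrigin 𝔟 γ.k γ.y i)
        (chartOrigin 𝔟 γ.k γ.y i + (chartParams 𝔟 γ.k).sitesPerDir 0)) ×ˢ (Finset.univ : Finset (Fin 4))) := by
  classical
  intro η η' hηη'
  have hb := isCylinder_blockField (N := N) 𝔟 γ.k γ.y γ.μ γ.ν γ.hμν hηη'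
  simp only [Set.indicator_apply, largeFieldEvent, Set.mem_setOf_eq, hb]

/-- The chart box of a level-`k` block-plaquette at `y` sits in the closed window of the collar cube of corner `b^k(y − m)` and side
`(2m+1)b^k` as soon as `m ≥ b`: base points `e` of the box satisfy `b^k(y_i − m) ≤ e_i ≤ b^k(y_i − m) + (2m+1)b^k`. [folklore] -/
theorem chartBox_window (𝔟 : BlockSize) (m : ℕ) (hm : 𝔟.b ≤ m) (k : ℕ) (y : Fin 4 → ℤ)
    {e : Literature.MathematicalPhysics.QuantumLattice.ZdEdge 4}
    (he : e ∈ (Fintype.piFinset fun i => Finset.Ico (chartOrigin 𝔟 k y i)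
        (chartOrigin 𝔟 k y i + (chartParams 𝔟 k).sitesPerDir 0)) ×ˢ (Finset.univ : Finset (Fin 4))) (j : Fin 4) :
    (𝔟.b : ℤ) ^ k * (y j - m) ≤ e.1 j ∧ e.1 j ≤ (𝔟.b : ℤ) ^ k * (y j - m) + ((2 * m + 1) * 𝔟.b ^ k : ℕ) := by
  have he' := (Finset.mem_Ico.1 (Fintype.mem_piFinset.1 (Finset.mem_product.1 he).1 j))
  rw [chartParams_sitesPerDir] at he'
  simp only [chartOrigin, Nat.sub_zero] at he'
  have hbk : (1 : ℤ) ≤ (𝔟.b : ℤ) ^ k := 𝔟.one_le_pow k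
  have hmb : (𝔟.b : ℤ) ≤ m := by exact_mod_cast hm
  have hpow : ((2 * 𝔟.b ^ (1 + k) : ℕ) : ℤ) = 2 * 𝔟.b * (𝔟.b : ℤ) ^ k := by push_cast; ring
  rw [hpow] at he'
  have e1 : (𝔟.b : ℤ) ^ k * (y j - ((𝔟.b : ℤ) - 1)) = (𝔟.b : ℤ) ^ k * y j - (𝔟.b : ℤ) * (𝔟.b : ℤ) ^ k + (𝔟.b : ℤ) ^ k := by
    ring
  have e2 : (𝔟.b : ℤ) ^ k * (y j - m) = (𝔟.b : ℤ) ^ k * y j - (m : ℤ) * (𝔟.b : ℤ) ^ k := by ring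
  have e3 : (m : ℤ) * (𝔟.b : ℤ) ^ k ≥ (𝔟.b : ℤ) * (𝔟.b : ℤ) ^ k := mul_le_mul_of_nonneg_right hmb (by linarith)
  rw [e1] at he'
  push_cast
  rw [e2]
  constructor
  · nlinarith [he'.1]
  · nlinarith [he'.2]

end Support

end Summit.QuantumFields.YangMills.Cruxes.UVSeamRec.DLRPeeling

end
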